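/-
Copyright (c) 2026 the pub-hodgecm-mathlib formalisation cell (harness21).  Prover seat hodgecm-mathlib-K2E4-p11 (g6), Track B ∕ K2-LIT, h413 = `stmt-HodgeConjecture-24833`,
line `K2_E1_TraceFormulaBeta`, campaign «5Res ENDGAME BY FAMILIES», ROADCARD §3′ D4′c (SD), dealer K2E1-plan (g7) deals (241)∕(243)∕(245): the ABSTRACT β∕γ step of the (MS-real) chain in
the pairing currency — a Banach-valued family whose squared norm is controlled by the diagonal four-term near a real pole `c` has `‖(z − c)•F(z)‖` BOUNDED near `c`, hence an (L²-)RESIDUE.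
Mathlib + ★ vector-α.
-/
import Summits.HodgeConjecture.HodgeConjecture.Theorems.K2E1MaassSelbergDiagonalRealAxisVector   -- ★ (this seat): the pairing-currency four-term bounds; brings ★ α p860161, ★ p860128 (`eventually_norm_le_of_im_ne_zero`)
import HarnessLib

/-!
# D4′c (SD) — `K2E1MaassSelbergRealPoleResidue`: (MS-c) AND THE RESIDUE AT A REAL POLE, ABSTRACTLY — if `‖F(z)‖² ≤ |R₁(z; a, w z, b z)|` off the real axis near a real `c > ½` (the
# diagonal Maass–Selberg identity of a truncated family), then `‖(z − c)•F(z)‖ ≤ C` on a punctured neighbourhood of `c` and `(z − c)•F(z) → u` (the residue) — Banach-valued, E1-agnostic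

Track B ∕ K2-LIT, crux h413 = `stmt-HodgeConjecture-24833`, route of record `HCCMUnconditional`; cell `hodgecm-mathlib`, squad K2, ENGINE E1; deal (241) road «(z−c)·E bounded near c ⇒ simple
pole + L² residue ★ γ-pattern».  THEOREMS ONLY (no `def`, no `instance`, no `notation`, no named-fact hypothesis, no `sorry`); lane `--supports stmt-HodgeConjecture-24833 --as helper`
(count-neutral).  Closes no socket.  ABSTRACT: `H` any complex normed space (E1: `L²(X_U, μ)` and `F z = [Λ^{T} E(z, v)]`, or `H = ℂ` and `F` a matrix entry); the Maass–Selberg input is the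
LETTER `hdiag` — the diagonal identity `‖F z‖² = Φ(z,z) = R₁(z; a, w z, b z)` of ★ `diag_eq_fourBracket_of_pairing_on'` (upper quarter-disc) and its lower twin, weakened to an inequality
on a punctured neighbourhood of `c` off the real axis — so this file is the χ-twin of ★ β3 `ms1_of_road` ∕ ★ γ `exists_tendsto_sub_smul_of_eventually_norm_le` with the E1 road data
replaced by their four scalar letters `(a, w, b)` + continuity∕differentiability of `F`.

THE MATHEMATICS ([MoeglinWaldspurger1995, IV.1.9–IV.1.11, IV.2.3, IV.3.12 (a)]; [Langlands1976, §7]; [Arthur1980TraceFormulaII, §4]).  Near a real pole `c` with `ρ₀ < 2c` of the holomorphic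
pairing `w` (`(z−c)w = d` analytic, `w` real on the real axis, `|z−c|²·b` bounded), ★ vector-α gives `|z−c|²·|R_{ρ₀}(z)| ≤ C₀` off the real axis near `c`; with `‖F z‖² ≤ |R_{ρ₀}(z)|` this is
`‖(z−c)•F z‖² ≤ C₀`, and continuity of `F` on a punctured neighbourhood carries the bound onto the real axis (★ p860128 `eventually_norm_le_of_im_ne_zero`): **(MS-c)**.  If moreover `F` is
differentiable on a punctured neighbourhood and `H` is complete, Riemann's removable-singularity theorem (Mathlib `Complex.tendsto_limUnder_of_differentiable_on_punctured_nhds_of_bounded_under`)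
gives the **RESIDUE** `u = lim_{z→c} (z−c)•F z`.  The same at a regular point `z₀` (`ρ₀ < 2 Re z₀`, `w` analytic at `z₀`, `b` bounded): `F` is bounded near `z₀` — **(MS-P)**.
* §1 **`exists_eventually_norm_le_of_diag`** ((MS-P) at a regular point), **`exists_eventually_norm_sub_smul_le_of_diag`** ((MS-c) at a real pole).
* §2 **`exists_tendsto_sub_smul_of_diag`** (the residue `u`, `H` complete) and the `ρ₀ = 1` print **`exists_tendsto_sub_smul_of_diag_one`** (`U(1,1)`: every `c > ½`).
CONSUMERS: the (SD) letters via ★ `K2E1ResidueOperatorLettersOfGram` (`H = ℂ`, entries ⇒ `hr`; `H = L²`, residues `u_v` ⇒ the Gram road ⇒ `hRsymm`∕`hRpos`).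
HONEST LABEL: HC_CM is proved only modulo the 7 printed citations (2 remaining named inputs: hLiu418 = `stmt-HodgeConjecture-24832`, h413 = `stmt-HodgeConjecture-24833`) until rung 0
closes; this file asserts no named fact and closes no socket; count-neutral; unconditional (binder form).

## References
* [MoeglinWaldspurger1995] C. Mœglin, J.-L. Waldspurger, *Spectral decomposition and Eisenstein series* (1995), IV.1.9–IV.1.11, IV.2.3, IV.3.12 (a).
* [Langlands1976] R. P. Langlands, *On the Functional Equations Satisfied by Eisenstein Series*, LNM 544 (1976), §7.
* [Arthur1980TraceFormulaII] J. Arthur, *A trace formula for reductive groups II*, Compositio Math. 40 (1980), §4.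
-/

set_option autoImplicit false
-- the mandated namespace repeats the single-problem summit's segment (`HodgeConjecture.HodgeConjecture`)
set_option linter.dupNamespace false

noncomputable section

open Set Filter Topology Metric Complex
open scoped ComplexConjugate
open Summit.HodgeConjecture.HodgeConjecture.Cruxes.H413.K2E1MaassSelbergDiagonalRealAxisCMThree (eventually_norm_le_of_im_ne_zero)
open Summit.HodgeConjecture.HodgeConjecture.Cruxes.H413.K2E1MaassSelbergDiagonalRealAxisVector (exists_norm_fourTerm_pairing_diag_le exists_normSq_mul_norm_fourTerm_pairing_diag_le)

namespace Summit.HodgeConjecture.HodgeConjecture.Cruxes.H413.K2E1MaassSelbergRealPoleResidue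

variable {H : Type*} [NormedAddCommGroup H] [NormedSpace ℂ H]

/-! ## §1 (MS-P) at a regular point and (MS-c) at a real pole, from the diagonal four-term letter -/

omit [NormedSpace ℂ H] in
/-- **(MS-P) FROM THE DIAGONAL LETTER**: if `‖F z‖² ≤ |R_{ρ₀}(z; a, w z, b z)|` off the real axis near `z₀` (`ρ₀ < 2·Re z₀`, `w` analytic at `z₀` and real on the real trace if `z₀` is real, `b`
bounded near `z₀`) and `F` is continuous on an open `V` containing a punctured neighbourhood of `z₀`, then `F` is BOUNDED on a punctured neighbourhood of `z₀`.
[cite: MoeglinWaldspurger1995, IV.2.3, IV.3.12 (a)] [cite: Arthur1980TraceFormulaII, §4] -/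
theorem exists_eventually_norm_le_of_diag (Cμ CK : ℝ) {T : ℝ} (hT : 0 < T) (a : ℝ) {b : ℂ → ℝ} {ρ₀ : ℂ} {w : ℂ → ℂ} {z₀ : ℂ} (hz₀ : ρ₀.re < 2 * z₀.re)
    (hw : AnalyticAt ℂ w z₀) (hreal : z₀.im = 0 → ∀ᶠ x : ℝ in 𝓝[≠] z₀.re, (w (x : ℂ)).im = 0) (hb : ∃ Mb : ℝ, ∀ᶠ z in 𝓝 z₀, |b z| ≤ Mb)
    (F : ℂ → H) {V : Set ℂ} (hV : IsOpen V) (hFc : ContinuousOn F V) (hmem : ∀ᶠ z in 𝓝[≠] z₀, z ∈ V)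
    (hdiag : ∀ᶠ z in 𝓝[≠] z₀, z.im ≠ 0 → ‖F z‖ ^ 2 ≤
      ‖((Cμ : ℝ) : ℂ) * (((CK : ℝ) : ℂ) *
        ((((T : ℝ) : ℂ) ^ (z + conj z - ρ₀) / (z + conj z - ρ₀)) * ((a : ℝ) : ℂ)
          + (((T : ℝ) : ℂ) ^ (z - conj z) / (z - conj z)) * conj (w z)
          - (((T : ℝ) : ℂ) ^ (-(z - conj z)) / (z - conj z)) * w z
          - (((T : ℝ) : ℂ) ^ (-(z + conj z - ρ₀)) / (z + conj z - ρ₀)) * ((b z : ℝ) : ℂ)))‖) :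
    ∃ C : ℝ, ∀ᶠ z in 𝓝[≠] z₀, ‖F z‖ ≤ C := by
  obtain ⟨C₀, hC₀⟩ := exists_norm_fourTerm_pairing_diag_le Cμ CK hT a hz₀ hw hreal hb
  refine ⟨Real.sqrt C₀, eventually_norm_le_of_im_ne_zero hV hFc hmem ?_⟩
  filter_upwards [mem_nhdsWithin_of_mem_nhds hC₀, hdiag] with z hz hzd hzim
  exact Real.le_sqrt_of_sq_le ((hzd hzim).trans (hz hzim))

/-- **(MS-c) FROM THE DIAGONAL LETTER AT A REAL POLE**: `c` real with `ρ₀ < 2c`; the holomorphic pairing `w` has a simple pole at `c` (`(z−c)·w = d` analytic at `c`), is real at the real points near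
`c`, and `|z−c|²·b` is bounded near `c`; `F : ℂ → H` is continuous on an open `V` containing a punctured neighbourhood of `c` and `‖F z‖² ≤ |R_{ρ₀}(z; a, w z, b z)|` off the real axis near
`c`.  THEN **`‖(z − c)•F z‖ ≤ C` on a punctured neighbourhood of `c`**. [cite: MoeglinWaldspurger1995, IV.2.3, IV.3.12 (a)] [cite: Langlands1976, §7] -/
theorem exists_eventually_norm_sub_smul_le_of_diag (Cμ CK : ℝ) {T : ℝ} (hT : 0 < T) (a : ℝ) {b : ℂ → ℝ} {ρ₀ : ℂ} {c : ℝ} (hc : ρ₀.re < 2 * c) {w d : ℂ → ℂ}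
    (hd : AnalyticAt ℂ d c) (hdw : ∀ᶠ z : ℂ in 𝓝[≠] (c : ℂ), d z = (z - c) * w z) (hreal : ∀ᶠ x : ℝ in 𝓝[≠] c, (w (x : ℂ)).im = 0)
    (hb : ∃ Mb : ℝ, ∀ᶠ z : ℂ in 𝓝[≠] (c : ℂ), ‖z - (c : ℂ)‖ ^ 2 * |b z| ≤ Mb)
    (F : ℂ → H) {V : Set ℂ} (hV : IsOpen V) (hFc : ContinuousOn F V) (hmem : ∀ᶠ z : ℂ in 𝓝[≠] (c : ℂ), z ∈ V)
    (hdiag : ∀ᶠ z : ℂ in 𝓝[≠] (c : ℂ), z.im ≠ 0 → ‖F z‖ ^ 2 ≤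
      ‖((Cμ : ℝ) : ℂ) * (((CK : ℝ) : ℂ) *
        ((((T : ℝ) : ℂ) ^ (z + conj z - ρ₀) / (z + conj z - ρ₀)) * ((a : ℝ) : ℂ)
          + (((T : ℝ) : ℂ) ^ (z - conj z) / (z - conj z)) * conj (w z)
          - (((T : ℝ) : ℂ) ^ (-(z - conj z)) / (z - conj z)) * w z
          - (((T : ℝ) : ℂ) ^ (-(z + conj z - ρ₀)) / (z + conj z - ρ₀)) * ((b z : ℝ) : ℂ)))‖) :
    ∃ C : ℝ, ∀ᶠ z : ℂ in 𝓝[≠] (c : ℂ), ‖(z - c) • F z‖ ≤ C := by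
  obtain ⟨C₀, hC₀⟩ := exists_normSq_mul_norm_fourTerm_pairing_diag_le Cμ CK hT a hc hd hdw hreal hb
  have hGc : ContinuousOn (fun z : ℂ => (z - c) • F z) V := (continuousOn_id.sub continuousOn_const).smul hFc
  refine ⟨Real.sqrt C₀, eventually_norm_le_of_im_ne_zero hV hGc hmem ?_⟩
  filter_upwards [hC₀, hdiag] with z hz hzd hzim
  refine Real.le_sqrt_of_sq_le ?_
  rw [norm_smul, mul_pow]
  exact (mul_le_mul_of_nonneg_left (hzd hzim) (sq_nonneg _)).trans (hz hzim)

/-! ## §2 The residue -/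

/-- **THE RESIDUE AT A REAL POLE FROM THE DIAGONAL LETTER** (`H` complete): under the hypotheses of (MS-c), if `F` is differentiable on a punctured neighbourhood of `c` then
`(z − c)•F z → u` for some `u ∈ H` (`z → c`, `z ≠ c`) — Riemann's removable singularity for `z ↦ (z−c)•F z`; in E1, `u = Res_{z=c} Λ^T E(z, v) ∈ L²`. [cite: MoeglinWaldspurger1995, IV.1.9–IV.1.11]
[cite: Langlands1976, §7] -/
theorem exists_tendsto_sub_smul_of_diag [CompleteSpace H] (Cμ CK : ℝ) {T : ℝ} (hT : 0 < T) (a : ℝ) {b : ℂ → ℝ} {ρ₀ : ℂ} {c : ℝ} (hc : ρ₀.re < 2 * c) {w d : ℂ → ℂ}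
    (hd : AnalyticAt ℂ d c) (hdw : ∀ᶠ z : ℂ in 𝓝[≠] (c : ℂ), d z = (z - c) * w z) (hreal : ∀ᶠ x : ℝ in 𝓝[≠] c, (w (x : ℂ)).im = 0)
    (hb : ∃ Mb : ℝ, ∀ᶠ z : ℂ in 𝓝[≠] (c : ℂ), ‖z - (c : ℂ)‖ ^ 2 * |b z| ≤ Mb)
    (F : ℂ → H) {V : Set ℂ} (hV : IsOpen V) (hFd : DifferentiableOn ℂ F V) (hmem : ∀ᶠ z : ℂ in 𝓝[≠] (c : ℂ), z ∈ V)
    (hdiag : ∀ᶠ z : ℂ in 𝓝[≠] (c : ℂ), z.im ≠ 0 → ‖F z‖ ^ 2 ≤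
      ‖((Cμ : ℝ) : ℂ) * (((CK : ℝ) : ℂ) *
        ((((T : ℝ) : ℂ) ^ (z + conj z - ρ₀) / (z + conj z - ρ₀)) * ((a : ℝ) : ℂ)
          + (((T : ℝ) : ℂ) ^ (z - conj z) / (z - conj z)) * conj (w z)
          - (((T : ℝ) : ℂ) ^ (-(z - conj z)) / (z - conj z)) * w z
          - (((T : ℝ) : ℂ) ^ (-(z + conj z - ρ₀)) / (z + conj z - ρ₀)) * ((b z : ℝ) : ℂ)))‖) :
    ∃ u : H, Tendsto (fun z : ℂ => (z - c) • F z) (𝓝[≠] (c : ℂ)) (𝓝 u) := by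
  obtain ⟨C, hC⟩ := exists_eventually_norm_sub_smul_le_of_diag Cμ CK hT a hc hd hdw hreal hb F hV hFd.continuousOn hmem hdiag
  have hdiff : ∀ᶠ z : ℂ in 𝓝[≠] (c : ℂ), DifferentiableAt ℂ (fun z : ℂ => (z - c) • F z) z := by
    filter_upwards [hmem] with z hz
    exact (differentiableAt_id.sub (differentiableAt_const _)).smul (hFd.differentiableAt (hV.mem_nhds hz))
  refine ⟨_, tendsto_limUnder_of_differentiable_on_punctured_nhds_of_bounded_under hdiff ⟨C, ?_⟩⟩
  simpa only [sub_self, zero_smul, sub_zero, Filter.eventually_map] using hC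

/-- **THE `U(1,1)` PRINT** (`ρ₀ = 1`, any real pole `c > ½`): residue of a family controlled by the `N = 2` diagonal four-term of ★ `poleControl_continued_chi_cm_two_of_pairing_on'`.
[cite: MoeglinWaldspurger1995, IV.1.11, IV.3.12 (a)] -/
theorem exists_tendsto_sub_smul_of_diag_one [CompleteSpace H] (Cμ CK : ℝ) {T : ℝ} (hT : 0 < T) (a : ℝ) {b : ℂ → ℝ} {c : ℝ} (hc : 1 / 2 < c) {w d : ℂ → ℂ}
    (hd : AnalyticAt ℂ d c) (hdw : ∀ᶠ z : ℂ in 𝓝[≠] (c : ℂ), d z = (z - c) * w z) (hreal : ∀ᶠ x : ℝ in 𝓝[≠] c, (w (x : ℂ)).im = 0)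
    (hb : ∃ Mb : ℝ, ∀ᶠ z : ℂ in 𝓝[≠] (c : ℂ), ‖z - (c : ℂ)‖ ^ 2 * |b z| ≤ Mb)
    (F : ℂ → H) {V : Set ℂ} (hV : IsOpen V) (hFd : DifferentiableOn ℂ F V) (hmem : ∀ᶠ z : ℂ in 𝓝[≠] (c : ℂ), z ∈ V)
    (hdiag : ∀ᶠ z : ℂ in 𝓝[≠] (c : ℂ), z.im ≠ 0 → ‖F z‖ ^ 2 ≤
      ‖((Cμ : ℝ) : ℂ) * (((CK : ℝ) : ℂ) *
        ((((T : ℝ) : ℂ) ^ (z + conj z - 1) / (z + conj z - 1)) * ((a : ℝ) : ℂ)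
          + (((T : ℝ) : ℂ) ^ (z - conj z) / (z - conj z)) * conj (w z)
          - (((T : ℝ) : ℂ) ^ (-(z - conj z)) / (z - conj z)) * w z
          - (((T : ℝ) : ℂ) ^ (-(z + conj z - 1)) / (z + conj z - 1)) * ((b z : ℝ) : ℂ)))‖) :
    ∃ u : H, Tendsto (fun z : ℂ => (z - c) • F z) (𝓝[≠] (c : ℂ)) (𝓝 u) :=
  exists_tendsto_sub_smul_of_diag Cμ CK hT a (ρ₀ := 1) (by rw [one_re]; linarith) hd hdw hreal hb F hV hFd hmem hdiag

end Summit.HodgeConjecture.HodgeConjecture.Cruxes.H413.K2E1MaassSelbergRealPoleResidue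

end
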